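import Mathlib.MeasureTheory.Integral.IntervalIntegral.FundThmCalculus
import Mathlib.MeasureTheory.Integral.DominatedConvergence
import Mathlib.Analysis.SpecialFunctions.Log.Deriv
import Literature.Geometry.Riemannian.RicciFlowVolume
import Literature.Geometry.Lorentzian.RiemannianMeasureDensity
import HarnessLib

/-!
# The volume element along a Ricci flow: `dV_t = e^{-∫ₛᵗ R} dV_s` (Topping 2006, (2.5.7))
(topic `Geometry/Riemannian`; everything proved, no definitions, no named facts)

Topping, *Lectures on the Ricci flow* (2006), Prop. 2.3.12: along a smooth family of metrics the
volume form evolves by `∂ₜ dV = ½ (tr ∂ₜ g) dV`; under the Ricci flow `∂ₜ g = −2 Ric` this is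
**(2.5.7)** `∂ₜ dV = −R dV`, whence (2.5.8) `dV/dt = −∫ R dV`. This file proves the integrated
form of (2.5.7) in the tree's rendering of the Riemannian volume
(`PseudoRiemannianMetric.riemVolume`: the Euclidean-normalised Hausdorff measure of the Riemannian
distance, `Volume.lean` / `CanonicalNeighbourhoods.lean`):

* `hasDerivWithinAt_det_gram_of_hasDerivWithinAt`, `hasDerivWithinAt_det_gram_basis_of_hasDerivWithinAt`,
  `hasDerivWithinAt_sqrt_det_gram_of_hasDerivWithinAt` — **Prop. 2.3.12 in a frame**, for any
  one-parameter family of metrics: if `∂ₛ g_s(eᵢ, eⱼ)|_{s=t} = h(eᵢ, eⱼ)` in a basis `e` of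
  `T_x M`, then `∂ₜ det g_{ij} = (tr_g h) det g_{ij}` and `∂ₜ √det g_{ij} = ½ (tr_g h) √det g_{ij}`
  (Jacobi's formula and the metric trace in a basis);
* `IsRicciFlow.det_gram_eq_mul_exp` — for a Ricci flow of Riemannian metrics on a convex time
  set `S` and a basis `e` of `T_x M`, the Gram determinant solves `∂ₜ det = −2 R det`
  (`hasDerivWithinAt_det_gram_basis`, `RicciFlowVolume.lean`) explicitly:
  `det (g_t(eᵢ, eⱼ)) = det (g_s(eᵢ, eⱼ)) · exp (−2 ∫ₛᵗ R(x, τ) dτ)` (logarithmic derivative and the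
  fundamental theorem of calculus, `R(x, ·)` being continuous in time,
  `IsRicciFlow.continuousOn_scalarCurvatureWith`);
* `IsRicciFlow.sqrt_det_chartGramMatrix_eq_exp_mul` — hence the chart densities satisfy
  `√det g_{ij}(y, t) = exp (−∫ₛᵗ R(φ⁻¹ y, τ) dτ) · √det g_{ij}(y, s)` — **(2.5.7) integrated**;
* `IsRicciFlow.riemVolume_eq_withDensity` — **`dV_{g(t)} = exp (−∫ₛᵗ R(·, τ) dτ) · dV_{g(s)}` as
  measures** on a closed manifold modelled on `ℝ^m` (the density-ratio lemma
  `riemannianMeasure_eq_withDensity_ofReal_of_chartGram` of `RiemannianMeasureDensity.lean`; the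
  density is continuous by the joint continuity of `R`, `continuousOn_scalarCurvatureWith_prod`),
  with the consequences `vol_eq_setLIntegral_exp` (`Vol_t(A) = ∫_A e^{−∫ₛᵗ R} dV_s`) and
  `lintegral_riemVolume_eq` (`∫ f dV_t = ∫ f e^{−∫ₛᵗ R} dV_s`).

The differentiated statement (2.5.8), `dV/dt = −∫ R dV`, is `IsRicciFlow.hasDerivAt_volume`
in `RicciFlowVolumeDeriv.lean` (dominated differentiation of `t ↦ ∫ e^{−∫ₛᵗ R} dV_s`).

## References

* P. Topping, *Lectures on the Ricci flow*, LMS Lecture Note Series 325, Cambridge Univ. Press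
  2006, Prop. 2.3.12 (p. 25) and (2.5.7)–(2.5.8) (p. 33). [Topping2006]
* R. S. Hamilton, *Three-manifolds with positive Ricci curvature*, J. Differential Geom. 17
  (1982) 255–306, §3. [Hamilton1982]
* I. Chavel, *Riemannian Geometry: A Modern Introduction*, 2nd ed., CUP 2006, §III.3. [Chavel2006]
-/

noncomputable section

open Set Module MeasureTheory Function Bundle intervalIntegral
open scoped Manifold ContDiff Topology ENNReal

namespace Literature.Geometry.Riemannian

open Lorentzian Lorentzian.PseudoRiemannianMetric

universe u v w

/-! ### A Gram determinant criterion for linear independence -/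

/-- If the Gram matrix `(B(vᵢ, vⱼ))` of a finite family under a bilinear form has nonzero
determinant, the family is linearly independent (a vanishing combination `∑ cᵢ vᵢ = 0` gives
`(B(vᵢ, vⱼ)) c = 0`). [folklore] -/
theorem linearIndependent_of_det_gram_ne_zero {V : Type*} [AddCommGroup V] [Module ℝ V]
    {ι : Type*} [Fintype ι] [DecidableEq ι] (B : LinearMap.BilinForm ℝ V) (v : ι → V)
    (h : (Matrix.of fun i j ↦ B (v i) (v j)).det ≠ 0) : LinearIndependent ℝ v := by
  refine Fintype.linearIndependent_iff.2 fun c hc ↦ ?_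
  by_contra hne
  have hc0 : c ≠ 0 := fun h0 ↦ hne fun i ↦ by simp [h0]
  refine h (Matrix.exists_mulVec_eq_zero_iff.1 ⟨c, hc0, ?_⟩)
  ext i
  have h1 : ∑ j, c j * B (v i) (v j) = 0 := by
    have := congrArg (B (v i)) hc
    simpa only [map_sum, map_smul, smul_eq_mul, map_zero] using this
  rw [Pi.zero_apply, ← h1, Matrix.mulVec, dotProduct]
  exact Finset.sum_congr rfl fun j _ ↦ by rw [Matrix.of_apply, mul_comm]

/-! ### Prop. 2.3.12 in a frame: `∂ₜ det g_{ij} = (tr_g ∂ₜg) det g_{ij}`, `∂ₜ √det = ½ (tr_g ∂ₜg) √det` -/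

section Family

variable {E : Type u} [NormedAddCommGroup E] [NormedSpace ℝ E]
  {H : Type v} [TopologicalSpace H] {I : ModelWithCorners ℝ E H}
  {M : Type w} [TopologicalSpace M] [ChartedSpace H M] [IsManifold I ∞ M] {n : ℕ∞ω}
  {g : ℝ → PseudoRiemannianMetric I n E (TangentSpace I : M → Type _)} {S : Set ℝ} {t : ℝ}
  {x : M} {ι : Type*} [Fintype ι] [DecidableEq ι]

/-- **The variation of a Gram determinant** (the frame computation behind Topping 2006,
Prop. 2.3.12): if for fixed vectors `vᵢ ∈ T_x M` each entry `s ↦ g_s(vᵢ, vⱼ)` has derivative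
`hᵢⱼ` at `t` within `S`, then `s ↦ det (g_s(vᵢ, vⱼ))` has derivative `tr (h · adj (g_t(vᵢ, vⱼ)))`
there (Jacobi's formula, `hasDerivWithinAt_det_rows`). [cite: Topping2006, Prop. 2.3.12 (p. 25)] -/
theorem hasDerivWithinAt_det_gram_of_hasDerivWithinAt (v : ι → TangentSpace I x)
    {hm : ι → ι → ℝ}
    (hd : ∀ i j, HasDerivWithinAt (fun s : ℝ ↦ (g s).val x (v i) (v j)) (hm i j) S t) :
    HasDerivWithinAt (fun s : ℝ ↦ (Matrix.of fun i j ↦ (g s).val x (v i) (v j)).det)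
      ((Matrix.of hm * (Matrix.of fun i j ↦ (g t).val x (v i) (v j)).adjugate).trace) S t := by
  set G : Matrix ι ι ℝ := Matrix.of fun i j ↦ (g t).val x (v i) (v j) with hG
  have hpi : HasDerivWithinAt (fun s : ℝ ↦ fun i j ↦ (g s).val x (v i) (v j)) hm S t :=
    hasDerivWithinAt_pi.2 fun i ↦ hasDerivWithinAt_pi.2 fun j ↦ hd i j
  refine (Literature.Analysis.Calculus.hasDerivWithinAt_det_rows hpi).congr_deriv ?_
  calc ∑ j, (Matrix.of (update (fun i j ↦ (g t).val x (v i) (v j)) j (hm j))).det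
      = ∑ j, ∑ i, hm j i * G.adjugate i j :=
        Finset.sum_congr rfl fun j _ ↦
          Literature.Analysis.Calculus.det_updateRow_eq_sum_mul_adjugate G j (hm j)
    _ = (Matrix.of hm * G.adjugate).trace := by
        rw [← Literature.Analysis.Calculus.sum_sum_adjugate_mul_eq_trace]
        exact Finset.sum_congr rfl fun j _ ↦ Finset.sum_congr rfl fun i _ ↦ mul_comm _ _

variable [FiniteDimensional ℝ E]

/-- **Topping 2006, Prop. 2.3.12 for the squared density**: in a basis `e` of `T_x M`, if
`∂ₛ g_s(eᵢ, eⱼ)|_{s=t} = h(eᵢ, eⱼ)` for a bilinear form `h` on `T_x M` (the time derivative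
`∂ₜ g` at `x`), then `∂ₛ det (g_s(eᵢ, eⱼ))|_{s=t} = (tr_{g_t} h) · det (g_t(eᵢ, eⱼ))`, the metric
trace `tr_g h = gⁱʲ hᵢⱼ` being `PseudoRiemannianMetric.trace` (`trace_eq_sum_mul_inv_gram`).
[cite: Topping2006, Prop. 2.3.12 (p. 25)] -/
theorem hasDerivWithinAt_det_gram_basis_of_hasDerivWithinAt (e : Basis ι ℝ (TangentSpace I x))
    {hb : LinearMap.BilinForm ℝ (TangentSpace I x)}
    (hd : ∀ i j, HasDerivWithinAt (fun s : ℝ ↦ (g s).val x (e i) (e j)) (hb (e i) (e j)) S t) :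
    HasDerivWithinAt (fun s : ℝ ↦ (Matrix.of fun i j ↦ (g s).val x (e i) (e j)).det)
      ((g t).trace x hb * (Matrix.of fun i j ↦ (g t).val x (e i) (e j)).det) S t := by
  have h1 := hasDerivWithinAt_det_gram_of_hasDerivWithinAt (g := g) e hd
  set G : Matrix ι ι ℝ := Matrix.of fun i j ↦ (g t).val x (e i) (e j) with hG
  set Hm : Matrix ι ι ℝ := Matrix.of fun i j ↦ hb (e i) (e j) with hHm
  have hΓ : IsUnit G.det := (g t).isUnit_det_gram x e
  have htr : (G⁻¹ * Hm).trace = (g t).trace x hb := by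
    rw [Matrix.trace_mul_comm, (g t).trace_eq_sum_mul_inv_gram x e hb]
    simp only [Matrix.trace, Matrix.diag_apply, Matrix.mul_apply, hHm, Matrix.of_apply, hG]
  rw [Literature.Analysis.Calculus.trace_mul_adjugate_eq_det_mul_trace _ _ hΓ, htr] at h1
  exact h1.congr_deriv (mul_comm _ _)

/-- **Topping 2006, Prop. 2.3.12: `∂ₜ dV = ½ (tr ∂ₜg) dV`**, for the density in a basis: with the
hypotheses of `hasDerivWithinAt_det_gram_basis_of_hasDerivWithinAt` and `g_t` Riemannian,
`∂ₛ √det (g_s(eᵢ, eⱼ))|_{s=t} = ½ (tr_{g_t} h) √det (g_t(eᵢ, eⱼ))`.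
[cite: Topping2006, Prop. 2.3.12 (p. 25)] -/
theorem hasDerivWithinAt_sqrt_det_gram_of_hasDerivWithinAt (e : Basis ι ℝ (TangentSpace I x))
    (hpos : (g t).IsRiemannian) {hb : LinearMap.BilinForm ℝ (TangentSpace I x)}
    (hd : ∀ i j, HasDerivWithinAt (fun s : ℝ ↦ (g s).val x (e i) (e j)) (hb (e i) (e j)) S t) :
    HasDerivWithinAt (fun s : ℝ ↦ Real.sqrt (Matrix.of fun i j ↦ (g s).val x (e i) (e j)).det)
      (2⁻¹ * (g t).trace x hb *
        Real.sqrt (Matrix.of fun i j ↦ (g t).val x (e i) (e j)).det) S t := by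
  have h1 := hasDerivWithinAt_det_gram_basis_of_hasDerivWithinAt e hd
  have hdet : 0 < (Matrix.of fun i j ↦ (g t).val x (e i) (e j)).det := by
    have := det_gram_pos e ((g t).toBilinForm x) (fun u w ↦ (g t).symm x u w)
      (fun u hu ↦ hpos x u hu)
    simpa only [toBilinForm_apply] using this
  refine (h1.sqrt hdet.ne').congr_deriv ?_
  have hs : Real.sqrt (Matrix.of fun i j ↦ (g t).val x (e i) (e j)).det ≠ 0 :=
    (Real.sqrt_pos.2 hdet).ne'
  field_simp
  rw [Real.sq_sqrt hdet.le]

end Family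

/-- A convex set of reals containing two distinct points has nonempty interior, hence unique
differentiability (`uniqueDiffOn_convex`). [folklore] -/
theorem uniqueDiffOn_of_convex_of_ne {S : Set ℝ} (hS : Convex ℝ S) {s t : ℝ} (hs : s ∈ S)
    (ht : t ∈ S) (hst : s ≠ t) : UniqueDiffOn ℝ S := by
  refine uniqueDiffOn_convex hS ?_
  have hsub : Ioo (min s t) (max s t) ⊆ interior S :=
    interior_maximal (Ioo_subset_Icc_self.trans (hS.ordConnected.uIcc_subset hs ht)) isOpen_Ioo
  exact (nonempty_Ioo.2 (min_lt_max.2 hst)).mono hsub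

/-! ### The Gram determinant along the flow, integrated: `det_t = det_s · e^{-2∫R}` -/

section Gram

variable {E : Type u} [NormedAddCommGroup E] [NormedSpace ℝ E] [FiniteDimensional ℝ E]
  [CompleteSpace E] {H : Type v} [TopologicalSpace H] {I : ModelWithCorners ℝ E H}
  {M : Type w} [TopologicalSpace M] [ChartedSpace H M] [IsManifold I ∞ M]
  {g : ℝ → PseudoRiemannianMetric I ∞ E (TangentSpace I : M → Type _)}
  {cov : ℝ → CovariantDerivative I E (TangentSpace I : M → Type _)} {S : Set ℝ}

/-- **The volume element along a Ricci flow, Gram form** (Topping 2006, (2.5.7) `∂ₜ dV = −R dV`,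
integrated): for a Ricci flow of Riemannian metrics on a convex time set `S`, a point `x`, a
basis `e` of `T_x M` and `s, t ∈ S`,
`det (g_t(eᵢ, eⱼ)) = det (g_s(eᵢ, eⱼ)) · exp (−2 ∫ₛᵗ R(x, τ) dτ)`: the positive function
`D(τ) = det (g_τ(eᵢ, eⱼ))` has `(log D)' = D'/D = −2 R(x, ·)` within `S`
(`hasDerivWithinAt_det_gram_basis`), `R(x, ·)` is continuous on `S`, and the fundamental theorem
of calculus on `[s, t] ⊆ S` gives `log D(t) − log D(s) = −2 ∫ₛᵗ R`.
[cite: Topping2006, Prop. 2.3.12 and (2.5.7) (pp. 25, 33)] -/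
theorem IsRicciFlow.det_gram_eq_mul_exp (h : IsRicciFlow g cov S) (hS : Convex ℝ S)
    (hR : ∀ t ∈ S, (g t).IsRiemannian) {s t : ℝ} (hs : s ∈ S)
    (ht : t ∈ S) (x : M) {ι : Type*} [Fintype ι] [DecidableEq ι]
    (e : Basis ι ℝ (TangentSpace I x)) :
    (Matrix.of fun i j ↦ (g t).val x (e i) (e j)).det =
      (Matrix.of fun i j ↦ (g s).val x (e i) (e j)).det *
        Real.exp (-2 * ∫ τ in s..t, (g τ).scalarCurvatureWith (cov τ) x) := by
  rcases eq_or_ne s t with rfl | hst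
  · simp
  have hU : UniqueDiffOn ℝ S := uniqueDiffOn_of_convex_of_ne hS hs ht hst
  set D : ℝ → ℝ := fun τ ↦ (Matrix.of fun i j ↦ (g τ).val x (e i) (e j)).det with hD
  set Rf : ℝ → ℝ := fun τ ↦ (g τ).scalarCurvatureWith (cov τ) x with hRf
  have hpos : ∀ τ ∈ S, 0 < D τ := fun τ hτ ↦ by
    have := det_gram_pos e ((g τ).toBilinForm x) (fun u w ↦ (g τ).symm x u w)
      (fun u hu ↦ hR τ hτ x u hu)
    simpa only [toBilinForm_apply] using this
  have hDd : ∀ τ ∈ S, HasDerivWithinAt D (-2 * Rf τ * D τ) S τ := fun τ hτ ↦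
    h.hasDerivWithinAt_det_gram_basis hτ x e
  have hψ : ∀ τ ∈ S, HasDerivWithinAt (fun τ ↦ Real.log (D τ)) (-2 * Rf τ) S τ := fun τ hτ ↦ by
    have hl := (hDd τ hτ).log (hpos τ hτ).ne'
    refine hl.congr_deriv ?_
    field_simp [(hpos τ hτ).ne']
  have hRc : ContinuousOn Rf S := h.continuousOn_scalarCurvatureWith hU x
  -- the fundamental theorem of calculus on `[s, t] ⊆ S`
  have hsub : uIcc s t ⊆ S := hS.ordConnected.uIcc_subset hs ht
  have hcont : ContinuousOn (fun τ ↦ Real.log (D τ)) (uIcc s t) :=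
    fun τ hτ ↦ ((hψ τ (hsub hτ)).continuousWithinAt).mono hsub
  have hderiv : ∀ τ ∈ Ioo (min s t) (max s t),
      HasDerivWithinAt (fun τ ↦ Real.log (D τ)) (-2 * Rf τ) (Ioi τ) τ := by
    intro τ hτ
    have hτS : S ∈ 𝓝 τ :=
      Filter.mem_of_superset (Ioo_mem_nhds hτ.1 hτ.2) (Ioo_subset_Icc_self.trans hsub)
    exact ((hψ τ (hsub (Ioo_subset_Icc_self hτ))).hasDerivAt hτS).hasDerivWithinAt
  have hint : IntervalIntegrable (fun τ ↦ -2 * Rf τ) volume s t :=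
    ((continuousOn_const.mul hRc).mono hsub).intervalIntegrable
  have hFTC := integral_eq_sub_of_hasDeriv_right hcont hderiv hint
  rw [intervalIntegral.integral_const_mul] at hFTC
  -- `log D t = log D s - 2 ∫ R`, exponentiate
  have hlog : Real.log (D t) = Real.log (D s) + -2 * ∫ τ in s..t, Rf τ := by linarith
  calc D t = Real.exp (Real.log (D t)) := (Real.exp_log (hpos t ht)).symm
    _ = D s * Real.exp (-2 * ∫ τ in s..t, Rf τ) := by
        rw [hlog, Real.exp_add, Real.exp_log (hpos s hs)]

end Gram

/-! ### Chart densities and the volume measure along the flow -/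

section Volume

variable {m : ℕ} {H : Type v} [TopologicalSpace H]
  {I : ModelWithCorners ℝ (EuclideanSpace ℝ (Fin m)) H}
  {M : Type w} [TopologicalSpace M] [ChartedSpace H M] [IsManifold I ∞ M]
  {g : ℝ → PseudoRiemannianMetric I ∞ (EuclideanSpace ℝ (Fin m)) (TangentSpace I : M → Type _)}
  {cov : ℝ → CovariantDerivative I (EuclideanSpace ℝ (Fin m)) (TangentSpace I : M → Type _)}
  {S : Set ℝ}

/-- **(2.5.7) integrated, for the chart densities**: along a Ricci flow of Riemannian metrics on a
convex time set `S`, for `s, t ∈ S`, a chart centre `x` and a point `y` of the chart target,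
`√det g_{ij}(y, t) = exp (−∫ₛᵗ R(φ⁻¹ y, τ) dτ) · √det g_{ij}(y, s)` — `det_gram_eq_mul_exp` for the
basis of coordinate vectors `∂ᵢ = d(φ⁻¹)_y eᵢ` of `T_{φ⁻¹ y} M` (a basis: its Gram determinant is
positive, `sqrt_det_chartGramMatrix_pos`). [cite: Topping2006, (2.5.7) (p. 33)] -/
theorem IsRicciFlow.sqrt_det_chartGramMatrix_eq_exp_mul (h : IsRicciFlow g cov S)
    (hS : Convex ℝ S) (hR : ∀ t ∈ S, (g t).IsRiemannian) {s t : ℝ}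
    (hs : s ∈ S) (ht : t ∈ S) (x : M) {y : EuclideanSpace ℝ (Fin m)}
    (hy : y ∈ (extChartAt I x).target) :
    Real.sqrt (chartGramMatrix ((g t).toContMDiffRiemannianMetric (hR t ht)) x y).det =
      Real.exp (-∫ τ in s..t, (g τ).scalarCurvatureWith (cov τ) ((extChartAt I x).symm y)) *
        Real.sqrt (chartGramMatrix ((g s).toContMDiffRiemannianMetric (hR s hs)) x y).det := by
  set q : M := (extChartAt I x).symm y with hq
  set v : Fin m → TangentSpace I q := fun i ↦
    mfderivWithin 𝓘(ℝ, EuclideanSpace ℝ (Fin m)) I (extChartAt I x).symm (range I) y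
      (EuclideanSpace.single i 1) with hv
  have hG : ∀ (τ : ℝ) (hτ : τ ∈ S),
      chartGramMatrix ((g τ).toContMDiffRiemannianMetric (hR τ hτ)) x y =
        Matrix.of fun i j ↦ (g τ).val q (v i) (v j) := fun τ hτ ↦ rfl
  -- the coordinate vectors form a basis of `T_q M`
  have hpos_s : 0 < (Matrix.of fun i j ↦ (g s).val q (v i) (v j)).det := by
    have := sqrt_det_chartGramMatrix_pos ((g s).toContMDiffRiemannianMetric (hR s hs)) x hy
    rw [hG s hs] at this
    exact Real.sqrt_pos.1 this
  haveI : FiniteDimensional ℝ (TangentSpace I q) :=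
    inferInstanceAs (FiniteDimensional ℝ (EuclideanSpace ℝ (Fin m)))
  have hli : LinearIndependent ℝ v :=
    linearIndependent_of_det_gram_ne_zero ((g s).toBilinForm q) v
      (by simpa only [toBilinForm_apply] using hpos_s.ne')
  have hcard : Fintype.card (Fin m) = finrank ℝ (TangentSpace I q) := by
    change Fintype.card (Fin m) = finrank ℝ (EuclideanSpace ℝ (Fin m))
    simp
  set e : Basis (Fin m) ℝ (TangentSpace I q) := basisOfLinearIndependentOfCardEqFinrank' v hli hcard
    with he_def
  have he : ⇑e = v := coe_basisOfLinearIndependentOfCardEqFinrank' v hli hcard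
  have key := h.det_gram_eq_mul_exp hS hR hs ht q e
  simp only [he] at key
  rw [hG t ht, hG s hs, key]
  set c : ℝ := ∫ τ in s..t, (g τ).scalarCurvatureWith (cov τ) q with hc
  have hexp : Real.exp (-2 * c) = Real.exp (-c) ^ 2 := by
    rw [sq, ← Real.exp_add]; ring_nf
  rw [hexp, Real.sqrt_mul' _ (sq_nonneg _), Real.sqrt_sq (Real.exp_pos _).le, mul_comm]

variable [I.Boundaryless]

/-- The density `p ↦ exp (−∫ₛᵗ R(p, τ) dτ)` is continuous on `M` for `s, t` in the (convex)
time set: `R` is jointly continuous on `M × S`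
(`IsRicciFlow.continuousOn_scalarCurvatureWith_prod`) and parametric interval integrals of
continuous functions are continuous. [folklore] -/
theorem IsRicciFlow.continuous_exp_neg_integral_scalarCurvature (h : IsRicciFlow g cov S)
    (hS : Convex ℝ S) {s t : ℝ} (hs : s ∈ S) (ht : t ∈ S) :
    Continuous fun p : M ↦
      Real.exp (-∫ τ in s..t, (g τ).scalarCurvatureWith (cov τ) p) := by
  rcases eq_or_ne s t with rfl | hst
  · simp only [intervalIntegral.integral_same, neg_zero, Real.exp_zero]
    exact continuous_const
  have hU : UniqueDiffOn ℝ S := uniqueDiffOn_of_convex_of_ne hS hs ht hst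
  have hsub : uIcc s t ⊆ S := hS.ordConnected.uIcc_subset hs ht
  have hle : min s t ≤ max s t := min_le_max
  -- a globally continuous integrand agreeing with `R` on `M × [s, t]`
  set F : M → ℝ → ℝ := fun p τ ↦
    (g (projIcc (min s t) (max s t) hle τ)).scalarCurvatureWith
      (cov (projIcc (min s t) (max s t) hle τ)) p with hF
  have hFc : Continuous F.uncurry := by
    have hj := h.continuousOn_scalarCurvatureWith_prod hU
    have hφ : Continuous fun z : M × ℝ ↦ (z.1, (projIcc (min s t) (max s t) hle z.2 : ℝ)) :=
      continuous_fst.prodMk (continuous_subtype_val.comp (continuous_projIcc.comp continuous_snd))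
    refine (hj.comp_continuous hφ fun z ↦ ⟨mem_univ _, hsub ?_⟩ :)
    exact (projIcc (min s t) (max s t) hle z.2).2
  have hI : Continuous fun p : M ↦ ∫ τ in s..t, F p τ :=
    intervalIntegral.continuous_parametric_intervalIntegral_of_continuous' hFc s t
  have heq : (fun p : M ↦ ∫ τ in s..t, (g τ).scalarCurvatureWith (cov τ) p) =
      fun p : M ↦ ∫ τ in s..t, F p τ := by
    funext p
    refine intervalIntegral.integral_congr fun τ hτ ↦ ?_
    simp only [hF, projIcc_of_mem hle hτ]
  have hI' : Continuous fun p : M ↦ ∫ τ in s..t, (g τ).scalarCurvatureWith (cov τ) p := by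
    rw [heq]; exact hI
  exact Real.continuous_exp.comp hI'.neg

variable [T2Space M] [CompactSpace M] [MeasurableSpace M] [BorelSpace M]

/-- **`dV_{g(t)} = e^{−∫ₛᵗ R} dV_{g(s)}`** (Topping 2006, (2.5.7) `∂ₜ dV = −R dV`, integrated; the
Ricci-flow analogue of `dμ_t = e^{t−s} dμ_s` for inverse mean curvature flow): for a Ricci flow of
Riemannian metrics on a closed manifold modelled on `ℝ^m`, on a convex time set `S`
and `s, t ∈ S`, the Riemannian volume measure of `g(t)` is that of `g(s)` with
density `p ↦ exp (−∫ₛᵗ R(p, τ) dτ)` — the chart densities are in this ratio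
(`sqrt_det_chartGramMatrix_eq_exp_mul`) and `riemannianMeasure_eq_withDensity_ofReal_of_chartGram`.
[cite: Topping2006, Prop. 2.3.12 and (2.5.7) (pp. 25, 33)] -/
theorem IsRicciFlow.riemVolume_eq_withDensity (h : IsRicciFlow g cov S) (hS : Convex ℝ S)
    (hR : ∀ t ∈ S, (g t).IsRiemannian) {s t : ℝ} (hs : s ∈ S)
    (ht : t ∈ S) :
    (g t).riemVolume = ((g s).riemVolume).withDensity fun p ↦
      ENNReal.ofReal (Real.exp (-∫ τ in s..t, (g τ).scalarCurvatureWith (cov τ) p)) := by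
  rw [riemVolume_eq (hR t ht), riemVolume_eq (hR s hs)]
  exact riemannianMeasure_eq_withDensity_ofReal_of_chartGram _ _
    (h.continuous_exp_neg_integral_scalarCurvature hS hs ht).measurable
    (fun p ↦ (Real.exp_pos _).le)
    fun x y hy ↦ h.sqrt_det_chartGramMatrix_eq_exp_mul hS hR hs ht x hy

/-- **`Vol_{g(t)}(A) = ∫_A e^{−∫ₛᵗ R} dV_{g(s)}`** for measurable `A`.
[cite: Topping2006, (2.5.7) (p. 33)] -/
theorem IsRicciFlow.vol_eq_setLIntegral_exp (h : IsRicciFlow g cov S) (hS : Convex ℝ S)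
    (hR : ∀ t ∈ S, (g t).IsRiemannian) {s t : ℝ} (hs : s ∈ S)
    (ht : t ∈ S) {A : Set M} (hA : MeasurableSet A) :
    (g t).vol A = ∫⁻ p in A, ENNReal.ofReal
      (Real.exp (-∫ τ in s..t, (g τ).scalarCurvatureWith (cov τ) p)) ∂(g s).riemVolume := by
  rw [PseudoRiemannianMetric.vol, h.riemVolume_eq_withDensity hS hR hs ht, withDensity_apply _ hA]

/-- **`∫ f dV_{g(t)} = ∫ f e^{−∫ₛᵗ R} dV_{g(s)}`** for measurable `f : M → [0, ∞]` — the form in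
which an integral against the evolving volume measure is differentiated in time (Topping 2006,
§2.3, §6). [cite: Topping2006, Prop. 2.3.12 and (2.5.7) (pp. 25, 33)] -/
theorem IsRicciFlow.lintegral_riemVolume_eq (h : IsRicciFlow g cov S) (hS : Convex ℝ S)
    (hR : ∀ t ∈ S, (g t).IsRiemannian) {s t : ℝ} (hs : s ∈ S)
    (ht : t ∈ S) {f : M → ℝ≥0∞} (hf : Measurable f) :
    ∫⁻ p, f p ∂(g t).riemVolume = ∫⁻ p, ENNReal.ofReal
      (Real.exp (-∫ τ in s..t, (g τ).scalarCurvatureWith (cov τ) p)) * f p ∂(g s).riemVolume := by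
  have hd : Measurable fun p : M ↦
      ENNReal.ofReal (Real.exp (-∫ τ in s..t, (g τ).scalarCurvatureWith (cov τ) p)) :=
    ENNReal.measurable_ofReal.comp
      (h.continuous_exp_neg_integral_scalarCurvature hS hs ht).measurable
  rw [h.riemVolume_eq_withDensity hS hR hs ht, lintegral_withDensity_eq_lintegral_mul _ hd hf]
  rfl

/-- The real-valued form: **`∫ f dV_{g(t)} = ∫ e^{−∫ₛᵗ R} f dV_{g(s)}`** for `f : M → ℝ`
(Bochner integrals; `integral_withDensity_eq_integral_toReal_smul` with a continuous positive
density). [cite: Topping2006, Prop. 2.3.12 and (2.5.7) (pp. 25, 33)] -/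
theorem IsRicciFlow.integral_riemVolume_eq (h : IsRicciFlow g cov S) (hS : Convex ℝ S)
    (hR : ∀ t ∈ S, (g t).IsRiemannian) {s t : ℝ} (hs : s ∈ S)
    (ht : t ∈ S) (f : M → ℝ) :
    ∫ p, f p ∂(g t).riemVolume =
      ∫ p, Real.exp (-∫ τ in s..t, (g τ).scalarCurvatureWith (cov τ) p) * f p ∂(g s).riemVolume := by
  have hd : Measurable fun p : M ↦
      ENNReal.ofReal (Real.exp (-∫ τ in s..t, (g τ).scalarCurvatureWith (cov τ) p)) :=
    ENNReal.measurable_ofReal.comp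
      (h.continuous_exp_neg_integral_scalarCurvature hS hs ht).measurable
  rw [h.riemVolume_eq_withDensity hS hR hs ht,
    integral_withDensity_eq_integral_toReal_smul hd
      (Filter.Eventually.of_forall fun _ ↦ ENNReal.ofReal_lt_top) f]
  refine integral_congr_ae (Filter.Eventually.of_forall fun p ↦ ?_)
  simp only [ENNReal.toReal_ofReal (Real.exp_pos _).le, smul_eq_mul]

end Volume

end Literature.Geometry.Riemannian

end
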